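import Mathlib
import Summits.Ventures.HodgeRepro2.T5AdicCompletionInert
import Summits.Ventures.HodgeRepro2.T5ConductorExistenceInflated
import Summits.Ventures.HodgeRepro2.T5AdicCompletionUnitIndex
import Summits.Ventures.HodgeRepro2.T5AdicCompletionNormSurjective
import Summits.Ventures.HodgeRepro2.T5AdicCompletionNormGroup
import Summits.Ventures.HodgeRepro2.T5LocalNormCharacter
import Summits.Ventures.HodgeRepro2.T5InertConductorShift
import Summits.Ventures.HodgeRepro2.T5ContinuousValuationExtension
import Summits.Ventures.HodgeRepro2.T5LocalFieldUnitsDecomposition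
import Summits.Ventures.HodgeRepro2.T5ConductorArithmetic

/-!
# T6N5LocalInertCompletion — Tier 6, M2 sub-step N5 (t6-p8's half): the character-side carriers of the inert
local sign datum on Mathlib's adic completions, and the datum condition `hβ` of `N5Local_main_inert`
(«conjugate-orthogonal characters of every exact conductor exist») PROVED there from p4's accepted kernel

Layer III for t6-p8's datum conditions, inert half (TARGET-T6 §9.2(b): a compat / carrier condition is admissible
only if Layer III discharges it — this file discharges two of them on the completions): for number fields
`K ⊆ L` and places `v`, `w` with `w | v` and `ϖ` a uniformiser of `K_v` that stays irreducible in `O_{L_w}`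
(the INERT case, as in p4's `T5AdicCompletionInert`), the carriers are `E := L_w^×`, the principal-unit filtration
`U n := image of U_{L_w}^n` (p4's `higherUnits` at `ϖ`, pushed to `L_w^×`), `F_v^× := range (baseUnits v w)`.
* `U_antitone` — the datum condition `hU`.
* `exists_CO_exact_level` — the datum condition `hβ`: for every `n ≥ 1` a character of `L_w^×` trivial on `F_v^×`
  (conjugate-orthogonal), smooth, of exact conductor `n` — from p4's `T5AdicCompletionInert.exists_character_exact_level`
  (a character of `O_{L_w}^×` trivial on `O_{K_v}^×`, trivial on `U^{n}`, non-trivial on `U^{n−1}`; inertia degree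
  `≥ 2`) inflated to `L_w^×` by p4's `T5ConductorExistenceInflated.exists_extension_trivial_on` (trivial on
  `F_v^×`, which contains the uniformiser and meets the units in `O_{K_v}^×`: p4's
  `T5AdicCompletionUnitIndex.range_baseUnits_inf_unitGroup`), with the conductor computed by p4's
  `T5ConductorArithmetic`.
* `μ`, `μ_mem_U_zero`, `μ_baseUnits` — the datum condition `hμ`: the unramified conjugate-symplectic character
  `μ := (−1)^{v_{L_w}(·)}` of `L_w^×` (trivial on `U 0 = O_{L_w}^×`) restricts on `F_v^×` to `η_v = ω_{E_v/F_v}`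
  = p4's `T5LocalNormCharacter.normChar` (the sign character of the norm group, `η_v(π_F) = −1`, trivial on
  units at an inert place — `normChar_apply_eq_zpow`), through `val_algebraMap_eq` (`v_{L_w} ∘ algebraMap = v_{K_v}`
  at an inert place).
The Tate-side fields of `InertSignDatum` (`Psi`, `Meas`, `epsT`, `ψ₀`, `ψ_δ`, `t`, `d_v`) have no Mathlib model and
stay parameters; the remaining datum conditions (`hψδ`, `hηt`, `hin`, `hψ0`) are about them.
README §8(d): uses an L-value-free non-vanishing device: NO.
-/

namespace Summit.Ventures.HodgeRepro2.T6.N5LocalInertCompletion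

open Summit.Ventures.HodgeRepro2 IsDedekindDomain HeightOneSpectrum
  Summit.Ventures.HodgeRepro2.T5ConductorArithmetic

variable {K : Type*} [Field K] [NumberField K] (v : HeightOneSpectrum (NumberField.RingOfIntegers K))
  {L : Type*} [Field L] [NumberField L] [Algebra K L] (w : HeightOneSpectrum (NumberField.RingOfIntegers L))
  [w.asIdeal.LiesOver v.asIdeal]
  [ContinuousSMul (v.adicCompletion K) (w.adicCompletion L)]
  [IsScalarTower K (v.adicCompletion K) (w.adicCompletion L)]

noncomputable section

/-- The inclusion of the integer units `O_{L_w}^× → L_w^×`. -/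
abbrev intUnits : (w.adicCompletionIntegers L)ˣ →* (w.adicCompletion L)ˣ :=
  Units.map (algebraMap (w.adicCompletionIntegers L) (w.adicCompletion L)).toMonoidHom

/-- The principal-unit filtration of `L_w^×` at the (inert) uniformiser `ϖ` of `K_v`: the image in `L_w^×` of
p4's `higherUnits (ϖ) n = {u ∈ O_{L_w}^× | ϖ^n ∣ u − 1}` (`U 0 = O_{L_w}^×`, `U n = 1 + P^n`). -/
def U (ϖ : v.adicCompletionIntegers K) (n : ℕ) : Subgroup (w.adicCompletion L)ˣ :=
  Subgroup.map (intUnits w)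
    (T5PrincipalUnitFiltration.higherUnits
      (algebraMap (v.adicCompletionIntegers K) (w.adicCompletionIntegers L) ϖ) n)

omit [IsScalarTower K (v.adicCompletion K) (w.adicCompletion L)] in
/-- The datum condition `hU`: the filtration is antitone. -/
theorem U_antitone (ϖ : v.adicCompletionIntegers K) : Antitone (U v w ϖ) := fun _ _ hmn =>
  Subgroup.map_mono (T5PrincipalUnitFiltration.higherUnits_antitone _ hmn)

/-- `F_v^× ⊆ L_w^×` as the range of p4's `baseUnits v w = Units.map (algebraMap K_v L_w)`. -/
abbrev Fsub : Subgroup (w.adicCompletion L)ˣ := (T5UnramifiedCharacter.baseUnits v w).range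

omit [IsScalarTower K (v.adicCompletion K) (w.adicCompletion L)] in
/-- A unit of `O_{L_w}` whose image lies in `F_v^×` comes from `O_{K_v}^×` (p4's
`range_baseUnits_inf_unitGroup`). -/
theorem exists_unitsMap_eq_of_mem_Fsub (s : (w.adicCompletionIntegers L)ˣ)
    (hs : intUnits w s ∈ Fsub v w) :
    ∃ r : (v.adicCompletionIntegers K)ˣ, s = T5PrincipalUnitComparison.unitsMap r := by
  have hmem : intUnits w s ∈ (T5UnramifiedCharacter.baseUnits v w).range ⊓
      Valued.v.valuationSubring.unitGroup :=
    Subgroup.mem_inf.mpr ⟨hs, (Valuation.mem_unitGroup_iff _ _ _).mpr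
      (T5AdicCompletionNormSurjective.val_coe_units_eq_one w s)⟩
  rw [T5AdicCompletionUnitIndex.range_baseUnits_inf_unitGroup v w] at hmem
  obtain ⟨s', ⟨r, hr⟩, hs'⟩ := hmem
  refine ⟨r, ?_⟩
  have hinj : Function.Injective (intUnits w) :=
    Units.map_injective (IsFractionRing.injective (w.adicCompletionIntegers L) (w.adicCompletion L))
  rw [hr]
  exact (hinj hs').symm

omit [IsScalarTower K (v.adicCompletion K) (w.adicCompletion L)] in
/-- The uniformiser unit of `L_w` built from `ϖ` lies in `F_v^×`. -/
theorem uniformizerUnit_mem_Fsub {ϖ : v.adicCompletionIntegers K} (hϖ : Irreducible ϖ)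
    (hϖS : Irreducible (algebraMap (v.adicCompletionIntegers K) (w.adicCompletionIntegers L) ϖ)) :
    T5LocalFieldUnitsDecomposition.uniformizerUnit
      (algebraMap (v.adicCompletionIntegers K) (w.adicCompletionIntegers L) ϖ) hϖS ∈ Fsub v w := by
  refine ⟨T5AdicCompletionNormGroup.uniformizerUnit v hϖ, ?_⟩
  apply Units.ext
  show (algebraMap (v.adicCompletion K) (w.adicCompletion L)) (ϖ : v.adicCompletion K) =
    (algebraMap (w.adicCompletionIntegers L) (w.adicCompletion L))
      (algebraMap (v.adicCompletionIntegers K) (w.adicCompletionIntegers L) ϖ)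
  calc (algebraMap (v.adicCompletion K) (w.adicCompletion L)) (ϖ : v.adicCompletion K)
      = (algebraMap (v.adicCompletion K) (w.adicCompletion L))
          (algebraMap (v.adicCompletionIntegers K) (v.adicCompletion K) ϖ) := rfl
    _ = algebraMap (v.adicCompletionIntegers K) (w.adicCompletion L) ϖ :=
        (IsScalarTower.algebraMap_apply (v.adicCompletionIntegers K) (v.adicCompletion K)
          (w.adicCompletion L) ϖ).symm
    _ = (algebraMap (w.adicCompletionIntegers L) (w.adicCompletion L))
          (algebraMap (v.adicCompletionIntegers K) (w.adicCompletionIntegers L) ϖ) :=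
        IsScalarTower.algebraMap_apply (v.adicCompletionIntegers K) (w.adicCompletionIntegers L)
          (w.adicCompletion L) ϖ

/-- The datum condition `hβ` on the completions: for every `n ≥ 1` a character `β` of `L_w^×` trivial on `F_v^×`
(conjugate-orthogonal), smooth (trivial on `U n`) and of exact conductor `n` for the filtration `U` —
p4's exact-level character of `O_{L_w}^×` (inertia degree `≥ 2`) inflated to `L_w^×`. -/
theorem exists_CO_exact_level {ϖ : v.adicCompletionIntegers K} (hϖ : Irreducible ϖ)
    (hϖS : Irreducible (algebraMap (v.adicCompletionIntegers K) (w.adicCompletionIntegers L) ϖ))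
    (hf : 2 ≤ (Ideal.span {ϖ}).inertiaDeg'
      (Ideal.span {algebraMap (v.adicCompletionIntegers K) (w.adicCompletionIntegers L) ϖ}))
    (n : ℕ) (hn : 1 ≤ n) :
    ∃ β : (w.adicCompletion L)ˣ →* ℂˣ, (∀ f ∈ Fsub v w, β f = 1) ∧
      (∃ m, U v w ϖ m ≤ β.ker) ∧ conductor (U v w ϖ) β = n := by
  obtain ⟨χ, h1, h2, u, hu, hu1⟩ :=
    T5AdicCompletionInert.exists_character_exact_level v w hϖ hϖS hf (n - 1)
  have hχ : ∀ s : (w.adicCompletionIntegers L)ˣ, intUnits w s ∈ Fsub v w → χ s = 1 := by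
    intro s hs
    obtain ⟨r, hr⟩ := exists_unitsMap_eq_of_mem_Fsub v w s hs
    rw [hr]
    exact h2 r
  obtain ⟨χ', hF, hext⟩ := T5ConductorExistenceInflated.exists_extension_trivial_on
    (algebraMap (v.adicCompletionIntegers K) (w.adicCompletionIntegers L) ϖ) hϖS (Fsub v w)
    (uniformizerUnit_mem_Fsub v w hϖ hϖS) χ hχ
  have hle : U v w ϖ n ≤ χ'.ker := by
    rintro x ⟨u', hu', rfl⟩
    rw [MonoidHom.mem_ker]
    change χ' (intUnits w u') = 1
    rw [hext]
    have : n - 1 + 1 = n := by omega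
    rw [← this] at hu'
    exact h1 u' hu'
  have hnle : ¬ U v w ϖ (n - 1) ≤ χ'.ker := by
    intro h
    have hmem : intUnits w u ∈ U v w ϖ (n - 1) := ⟨u, hu, rfl⟩
    have := h hmem
    rw [MonoidHom.mem_ker] at this
    change χ' (intUnits w u) = 1 at this
    rw [hext] at this
    exact hu1 this
  refine ⟨χ', hF, ⟨n, hle⟩, ?_⟩
  have hc1 : conductor (U v w ϖ) χ' ≤ n := conductor_le_of_le_ker hle
  have hc2 : ¬ conductor (U v w ϖ) χ' ≤ n - 1 := fun h =>
    hnle (le_ker_of_conductor_le (U_antitone v w ϖ) ⟨n, hle⟩ h)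
  omega

/-! ### The unramified conjugate-symplectic character `μ` (the datum condition `hμ`) -/

/-- `toAdd (unzero x) = log x` for `x ≠ 0` in `WithZero (Multiplicative ℤ)`. -/
theorem toAdd_unzero_eq_log {x : WithZero (Multiplicative ℤ)} (hx : x ≠ 0) :
    Multiplicative.toAdd (WithZero.unzero hx) = x.log := by
  induction x with
  | zero => exact absurd rfl hx
  | coe a => rw [WithZero.unzero_coe]; rfl

/-- The valuation of `L_w` on units, as a homomorphism to `Multiplicative ℤ`. -/
def valHom : (w.adicCompletion L)ˣ →* Multiplicative ℤ :=
  WithZero.unitsWithZeroEquiv.toMonoidHom.comp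
    (Units.map (Valued.v : Valuation (w.adicCompletion L)
      (WithZero (Multiplicative ℤ))).toMonoidWithZeroHom.toMonoidHom)

/-- `toAdd (valHom x) = log v(x)`. -/
theorem toAdd_valHom (x : (w.adicCompletion L)ˣ) :
    Multiplicative.toAdd (valHom w x) = (Valued.v (x : w.adicCompletion L)).log := by
  simp only [valHom, MonoidHom.comp_apply, MulEquiv.coe_toMonoidHom, WithZero.unitsWithZeroEquiv_apply]
  exact toAdd_unzero_eq_log _

/-- The unramified character `μ := (−1)^{v_{L_w}(·)}` of `L_w^×` (TIER5 §N5.11.2: «μ the unramified character of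
`E_v^×` with `μ(π_E) = −1`», conjugate-symplectic at an inert place). -/
def μ : (w.adicCompletion L)ˣ →* ℂˣ := (zpowersHom ℂˣ (-1)).comp (valHom w)

/-- `μ(x) = (−1)^{log v(x)}`. -/
theorem μ_apply (x : (w.adicCompletion L)ˣ) :
    μ w x = (-1 : ℂˣ) ^ (Valued.v (x : w.adicCompletion L)).log := by
  show (-1 : ℂˣ) ^ (Multiplicative.toAdd (valHom w x)) = _
  rw [toAdd_valHom]

omit [IsScalarTower K (v.adicCompletion K) (w.adicCompletion L)] in
/-- `μ` is unramified: trivial on `U 0 = O_{L_w}^×`. -/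
theorem μ_mem_U_zero (ϖ : v.adicCompletionIntegers K) : U v w ϖ 0 ≤ (μ w).ker := by
  rintro x ⟨u, -, rfl⟩
  rw [MonoidHom.mem_ker, μ_apply]
  show (-1 : ℂˣ) ^ (Valued.v ((u : w.adicCompletionIntegers L) : w.adicCompletion L)).log = 1
  rw [T5AdicCompletionNormSurjective.val_coe_units_eq_one w u, WithZero.log_one, zpow_zero]

omit [ContinuousSMul (v.adicCompletion K) (w.adicCompletion L)]
  [IsScalarTower K (v.adicCompletion K) (w.adicCompletion L)] in
/-- `F_v^×` is the isomorphic image of `K_v^×` under `baseUnits` (injective: `algebraMap K_v L_w` is a field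
homomorphism). -/
theorem baseUnits_injective : Function.Injective (T5UnramifiedCharacter.baseUnits v w) :=
  Units.map_injective (algebraMap (v.adicCompletion K) (w.adicCompletion L)).injective

omit [ContinuousSMul (v.adicCompletion K) (w.adicCompletion L)]
  [IsScalarTower K (v.adicCompletion K) (w.adicCompletion L)] [w.asIdeal.LiesOver v.asIdeal] in
/-- `(−1)^k` in `ℂˣ` is the image of `(−1)^{−k}` of `ℤˣ` (the two powers of `−1` with opposite exponents agree). -/
theorem neg_one_zpow_eq_map_cast (k : ℤ) :
    (-1 : ℂˣ) ^ k = Units.map (Int.castRingHom ℂ).toMonoidHom ((-1 : ℤˣ) ^ (-k)) := by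
  rcases Int.even_or_odd k with hk | hk
  · have h1 : (-1 : ℂˣ) ^ k = 1 := hk.neg_one_zpow
    have h2 : (-1 : ℤˣ) ^ (-k) = 1 := hk.neg.neg_one_zpow
    rw [h1, h2, map_one]
  · have h1 : (-1 : ℂˣ) ^ k = -1 := hk.neg_one_zpow
    have h2 : (-1 : ℤˣ) ^ (-k) = -1 := hk.neg.neg_one_zpow
    rw [h1, h2]
    ext
    simp

/-- `η_v` on `F_v^×`: p4's norm character `normChar v w σ hind : K_v^× →* ℤˣ` (the sign character of the norm
group, = `ω_{E_v/F_v}`) transported to `F_v^× = range (baseUnits v w)` and pushed into `ℂˣ`. -/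
def ηF (σ : Gal(w.adicCompletion L/v.adicCompletion K))
    (hind : (T5AdicCompletionNormGroup.normGroup v w σ).index = 2) : Fsub v w →* ℂˣ :=
  (Units.map (Int.castRingHom ℂ).toMonoidHom).comp
    ((T5LocalNormCharacter.normChar v w σ hind).comp
      (MonoidHom.ofInjective (baseUnits_injective v w)).symm.toMonoidHom)

omit [ContinuousSMul (v.adicCompletion K) (w.adicCompletion L)]
  [IsScalarTower K (v.adicCompletion K) (w.adicCompletion L)] in
/-- `ηF (baseUnits y) = normChar y` (pushed into `ℂˣ`). -/
theorem ηF_baseUnits (σ : Gal(w.adicCompletion L/v.adicCompletion K))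
    (hind : (T5AdicCompletionNormGroup.normGroup v w σ).index = 2) (y : (v.adicCompletion K)ˣ) :
    ηF v w σ hind ⟨T5UnramifiedCharacter.baseUnits v w y, ⟨y, rfl⟩⟩ =
      Units.map (Int.castRingHom ℂ).toMonoidHom (T5LocalNormCharacter.normChar v w σ hind y) := by
  have h : (⟨T5UnramifiedCharacter.baseUnits v w y, ⟨y, rfl⟩⟩ : Fsub v w) =
      MonoidHom.ofInjective (baseUnits_injective v w) y :=
    Subtype.ext (MonoidHom.ofInjective_apply _).symm
  simp only [ηF, MonoidHom.comp_apply, MulEquiv.coe_toMonoidHom, h, MulEquiv.symm_apply_apply]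

omit [IsScalarTower K (v.adicCompletion K) (w.adicCompletion L)] in
/-- The datum condition `hμ` on the completions: `μ` is conjugate-symplectic, i.e. agrees with `η_v` on `F_v^×`
(`μ(π_F) = −1 = η_v(π_F)`, both trivial on the units: `v_{L_w}(algebraMap y) = v_{K_v}(y)` at an inert place and
p4's `normChar_apply_eq_zpow` / `normChar_uniformizer_eq_neg_one`). -/
theorem μ_eq_ηF (σ : Gal(w.adicCompletion L/v.adicCompletion K))
    (hσ : σ ≠ 1) (h2 : Module.finrank (v.adicCompletion K) (w.adicCompletion L) = 2)
    {ϖ : v.adicCompletionIntegers K} (hϖ : Irreducible ϖ)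
    (hϖS : Irreducible (algebraMap (v.adicCompletionIntegers K) (w.adicCompletionIntegers L) ϖ))
    (hind : (T5AdicCompletionNormGroup.normGroup v w σ).index = 2) (f : Fsub v w) :
    μ w f = ηF v w σ hind f := by
  obtain ⟨y, hy⟩ := f.2
  have hf : f = ⟨T5UnramifiedCharacter.baseUnits v w y, ⟨y, rfl⟩⟩ := Subtype.ext hy.symm
  rw [hf, ηF_baseUnits, T5LocalNormCharacter.normChar_apply_eq_zpow v w σ hind h2 hϖ hϖS hσ y,
    T5LocalNormCharacter.normChar_uniformizer_eq_neg_one v w σ hind h2 hϖ hϖS hσ]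
  change μ w (T5UnramifiedCharacter.baseUnits v w y) = _
  rw [μ_apply]
  have hval : Valued.v ((T5UnramifiedCharacter.baseUnits v w y : (w.adicCompletion L)ˣ) :
      w.adicCompletion L) = Valued.v (y : v.adicCompletion K) :=
    T5InertConductorShift.val_algebraMap_eq v w hϖ hϖS (y : v.adicCompletion K)
  rw [hval]
  exact neg_one_zpow_eq_map_cast _

end

end Summit.Ventures.HodgeRepro2.T6.N5LocalInertCompletion
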